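import Mathlib
import HarnessLib
import Summits.ResolutionOfSingularities.ResolutionOfSingularities.Theorems.HomologicalConductorPersistenceConductorCeiling
import Summits.ResolutionOfSingularities.ResolutionOfSingularities.Theorems.HomologicalConductorPersistenceConductorCoextension
import Summits.ResolutionOfSingularities.ResolutionOfSingularities.Theorems.HomologicalConductorPersistenceSurfaceHullCover

/-!
# The conductor ceiling `ca³(B) ⊆ 𝔠` in RING-MAP form: `B → C` injective, `C` a domain module-finite over `B`,
# one nonzero conductor element

Route `ResolutionOfSingularities/HomologicalConductor`, chain W4.4b, rung S-2 `PersistenceSurface`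
(stmt-ResolutionOfSingularities-19970): Σ8 cell and the curve side of the cA-arena; seat res-L1-w44b-stub-2 (gen 5).
[OURS · L1 w44b; AI-written, weaker than expert review; NOT a statement of the manuscript under study (Hironaka 2017),
and no statement of that manuscript is used.]

res-L1-w44b-lead-1's CONDUCTOR CEILING (`…PersistenceConductorCeiling.cohomologyAnnihilatorOfDegree_three_le_conductor`,
p550697) is stated for an `R`-submodule `M ∋ 1` of the fraction FIELD `K` of `R`.  The curve computations of the chain
present the normalisation as a RING MAP instead (a parametrisation `φ : R → k[τ]`, as in `…PersistenceMonomialCusp`,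
`…PersistenceKC3LowerCurve`, `…PersistenceConductorStable`).  This file re-proves the ceiling in that form, with a
direct proof on the dual `Hom_B(C, B)` (no passage through `K`):

* `algebraMap_dual_apply_eq_mul` — for `C` a domain over `B` and a conductor element `c₀` (`c₀·C ⊆ B`) that is
  nonzero in `C`, every `B`-linear `θ : C → B` is `γ ↦ γ·θ(1)` (in `C`);
* `apply_one_smul_comm` — hence `θ(1) • θ' = θ'(1) • θ` for all `θ, θ' ∈ Hom_B(C, B)`;
* **`exists_eq_mul_of_mem_cohomologyAnnihilatorOfDegree_three`** — THE CEILING: if moreover `B` is noetherian and `C`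
  is module-finite over `B`, then every `x ∈ ca³(B)` is a conductor element: `∀ γ, ∃ b, b = x·γ` in `C`.  Proof:
  `Hom_B(C,B)` is the dual of a finitely generated module, hence a second syzygy (p550697's `exists_isSyzygy_two_dual`),
  so `x • 𝟙` factors through some `Bˢ` (CA1), `x • θ = Σᵢ ιᵢ(θ) • pᵢ`; for `θ₀ = (γ ↦ c₀γ)` and the twists
  `γ·pᵢ = pᵢ ∘ (·γ)` the identity `c₀ • (γ·pᵢ) = pᵢ(γ) • θ₀` gives `c₀ · Σᵢ ιᵢ(γ·pᵢ) = (x • θ₀)(γ) = x c₀ γ`, and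
  `c₀ ≠ 0` cancels in the domain `C`;
* `cohomologyAnnihilatorOfDegree_le_of_forall_iff` — packaged against any ideal `𝔠 ≤ B` handed over with its
  defining property; `exists_eq_mul_of_mem_cohomologyAnnihilator_of_eq` — all levels when `ca(B) = caⁿ(B)` for some
  `n ≤ 3` (saturation, e.g. hypersurface curves and surfaces).

References (mechanism only): S. B. Iyengar, R. Takahashi, IMRN 2016, Remark 2.13 [`IyengarTakahashi2014`].
-/

noncomputable section

-- single-problem summit: the doubled namespace component `ResolutionOfSingularities` is forced
set_option linter.dupNamespace false

namespace Summit.ResolutionOfSingularities.ResolutionOfSingularities.Theorems.HomologicalConductor.ConductorCeilingRingHom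

open CategoryTheory Literature.RingTheory.CohomologyAnnihilator
open Summit.ResolutionOfSingularities.ResolutionOfSingularities.Theorems.NoZeno.SandwichCluster
open Summit.ResolutionOfSingularities.ResolutionOfSingularities.Theorems.HomologicalConductor.PersistenceConductorCeiling
  (exists_isSyzygy_two_dual)
open Summit.ResolutionOfSingularities.ResolutionOfSingularities.Theorems.HomologicalConductor.PersistenceConductorCoextension
  (exists_linearMap_conductor)
open Summit.ResolutionOfSingularities.ResolutionOfSingularities.Theorems.HomologicalConductor.PersistenceSurfaceHullCover

universe u

variable {B C : Type u} [CommRing B] [CommRing C] [Algebra B C]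

/-- For `B → C` injective, `C` a domain and a conductor element `c₀` nonzero in `C`, every `B`-linear `θ : C → B`
satisfies `θ(γ) = γ·θ(1)` in `C` (`c₀·θ(γ) = θ(c₀γ) = (c₀γ)·θ(1)` as `c₀γ ∈ B`). [folklore] -/
theorem algebraMap_dual_apply_eq_mul [IsDomain C] {c₀ : B}
    (hc₀ : ∀ γ : C, ∃ b : B, algebraMap B C b = algebraMap B C c₀ * γ) (hc₀0 : algebraMap B C c₀ ≠ 0)
    (θ : Module.Dual B C) (γ : C) :
    algebraMap B C (θ γ) = γ * algebraMap B C (θ 1) := by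
  obtain ⟨b, hb⟩ := hc₀ γ
  have h1 : c₀ • γ = b • (1 : C) := by
    rw [Algebra.smul_def, Algebra.smul_def, mul_one, hb]
  have h2 : c₀ * θ γ = b * θ 1 := by
    rw [← smul_eq_mul, ← smul_eq_mul, ← map_smul, ← map_smul, h1]
  have h3 := congrArg (algebraMap B C) h2
  rw [map_mul, map_mul, hb] at h3
  -- `c₀ · θ γ = c₀ γ · θ 1` in `C`; cancel `c₀`
  have h4 : algebraMap B C c₀ * (algebraMap B C (θ γ) - γ * algebraMap B C (θ 1)) = 0 := by
    rw [mul_sub, h3]; ring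
  rcases mul_eq_zero.mp h4 with h | h
  · exact absurd h hc₀0
  · exact sub_eq_zero.mp h

/-- **`θ(1) • θ' = θ'(1) • θ`** for `B`-linear `θ, θ' : C → B` (both are `δ ↦ θ(1)θ'(1)δ` in `C`). [folklore] -/
theorem apply_one_smul_comm [IsDomain C] (hinj : Function.Injective (algebraMap B C)) {c₀ : B}
    (hc₀ : ∀ γ : C, ∃ b : B, algebraMap B C b = algebraMap B C c₀ * γ) (hc₀0 : algebraMap B C c₀ ≠ 0)
    (θ θ' : Module.Dual B C) : θ 1 • θ' = θ' 1 • θ := by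
  refine LinearMap.ext fun δ => hinj ?_
  rw [LinearMap.smul_apply, LinearMap.smul_apply, smul_eq_mul, smul_eq_mul, map_mul, map_mul,
    algebraMap_dual_apply_eq_mul hc₀ hc₀0 θ' δ, algebraMap_dual_apply_eq_mul hc₀ hc₀0 θ δ]
  ring

/-- A linear map out of `Fin s → B` is the sum of its values on the coordinate vectors. [folklore] -/
theorem linearMap_pi_apply_eq_sum {M : Type u} [AddCommGroup M] [Module B M] {s : ℕ}
    (π : (Fin s → B) →ₗ[B] M) (w : Fin s → B) : π w = ∑ i, w i • π (Pi.single i 1) := by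
  conv_lhs => rw [← Finset.univ_sum_single w]
  rw [map_sum]
  refine Finset.sum_congr rfl fun i _ => ?_
  rw [← map_smul]
  congr 1
  funext j
  rw [Pi.smul_apply, Pi.single_apply, Pi.single_apply, smul_eq_mul]
  split_ifs <;> simp

/-- **THE CONDUCTOR CEILING, ring-map form.**  `B` noetherian, `B → C` injective with `C` a domain module-finite over
`B`, `c₀` a conductor element nonzero in `C`.  Then every `x ∈ ca³(B)` is a conductor element: for every `γ ∈ C`
there is `b ∈ B` with `b = x·γ` in `C`. [cite: IyengarTakahashi2014, Remark 2.13] -/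
theorem exists_eq_mul_of_mem_cohomologyAnnihilatorOfDegree_three [IsNoetherianRing B] [IsDomain C]
    [Module.Finite B C] (hinj : Function.Injective (algebraMap B C)) {c₀ : B}
    (hc₀ : ∀ γ : C, ∃ b : B, algebraMap B C b = algebraMap B C c₀ * γ) (hc₀0 : algebraMap B C c₀ ≠ 0)
    {x : B} (hx : x ∈ cohomologyAnnihilatorOfDegree B 3) (γ : C) :
    ∃ b : B, algebraMap B C b = algebraMap B C x * γ := by
  classical
  -- `Hom_B(C, B)` is a second syzygy, so `x • 𝟙` factors through some `Bˢ`
  obtain ⟨X, hX, h2⟩ := exists_isSyzygy_two_dual (A := B) C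
  have hsa : StablyAnnihilates B x (ModuleCat.of B (Module.Dual B C)) :=
    (mem_cohomologyAnnihilatorOfDegree_succ_iff_forall_isSyzygy (n := 2) x).mp hx X _ hX h2
  obtain ⟨s, ι, π, hιπ⟩ := (stablyAnnihilates_iff_exists_linearMap x (ModuleCat.of B (Module.Dual B C))).mp hsa
  have hπι : ∀ θ : Module.Dual B C, π (ι θ) = x • θ := fun θ => by
    simpa using LinearMap.congr_fun hιπ θ
  -- `θ₀ = (δ ↦ c₀ δ)`
  obtain ⟨θ₀, hθ₀⟩ := exists_linearMap_conductor hinj hc₀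
  have hθ₀1 : θ₀ 1 = c₀ := hinj (by rw [hθ₀, mul_one])
  -- the twists `γ·pᵢ`
  let p : Fin s → Module.Dual B C := fun i => π (Pi.single i 1)
  let q : Fin s → Module.Dual B C := fun i => (p i) ∘ₗ LinearMap.mulLeft B γ
  have hq1 : ∀ i, q i 1 = p i γ := fun i => by
    simp [q, LinearMap.mulLeft_apply]
  -- `c₀ • qᵢ = pᵢ(γ) • θ₀`
  have hcq : ∀ i, c₀ • q i = p i γ • θ₀ := fun i => by
    rw [← hθ₀1, apply_one_smul_comm hinj hc₀ hc₀0 θ₀ (q i), hq1]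
  refine ⟨∑ i, ι (q i) i, ?_⟩
  -- `c₀ · Σ ιᵢ(qᵢ) = (x • θ₀)(γ) = x θ₀ γ`
  have key : c₀ * ∑ i, ι (q i) i = x * θ₀ γ := by
    rw [Finset.mul_sum]
    have hterm : ∀ i, c₀ * ι (q i) i = p i γ * ι θ₀ i := fun i => by
      rw [← smul_eq_mul, ← Pi.smul_apply, ← map_smul, hcq i, map_smul, Pi.smul_apply, smul_eq_mul]
    simp_rw [hterm]
    have h := hπι θ₀
    rw [linearMap_pi_apply_eq_sum π (ι θ₀)] at h
    have h' := LinearMap.congr_fun h γ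
    rw [LinearMap.coe_sum, Finset.sum_apply, LinearMap.smul_apply] at h'
    simp only [LinearMap.smul_apply, smul_eq_mul] at h'
    rw [← h']
    exact Finset.sum_congr rfl fun i _ => mul_comm _ _
  have key' := congrArg (algebraMap B C) key
  rw [map_mul, map_mul, hθ₀ γ] at key'
  -- cancel `c₀`
  have h4 : algebraMap B C c₀ * (algebraMap B C (∑ i, ι (q i) i) - algebraMap B C x * γ) = 0 := by
    rw [mul_sub, key']; ring
  rcases mul_eq_zero.mp h4 with h | h
  · exact absurd h hc₀0
  · exact sub_eq_zero.mp h

/-- **`ca³(B) ⊆ 𝔠`, packaged**: for any ideal `𝔠 ≤ B` handed over with its defining property «`b ∈ 𝔠` iff `b·C ⊆ B`».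
[folklore] -/
theorem cohomologyAnnihilatorOfDegree_three_le_of_forall_iff [IsNoetherianRing B] [IsDomain C] [Module.Finite B C]
    (hinj : Function.Injective (algebraMap B C)) {c₀ : B}
    (hc₀ : ∀ γ : C, ∃ b : B, algebraMap B C b = algebraMap B C c₀ * γ) (hc₀0 : algebraMap B C c₀ ≠ 0)
    (𝔠 : Ideal B) (h𝔠 : ∀ b : B, b ∈ 𝔠 ↔ ∀ γ : C, ∃ b' : B, algebraMap B C b' = algebraMap B C b * γ) :
    cohomologyAnnihilatorOfDegree B 3 ≤ 𝔠 := fun _ hx =>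
  (h𝔠 _).mpr (exists_eq_mul_of_mem_cohomologyAnnihilatorOfDegree_three hinj hc₀ hc₀0 hx)

/-- **All levels under saturation**: if `ca(B) = caⁿ(B)` for some `n ≤ 3` (e.g. `B` a hypersurface over a regular
ring of dimension `≤ 2`), then every `x ∈ ca(B)` is a conductor element. [folklore] -/
theorem exists_eq_mul_of_mem_cohomologyAnnihilator_of_eq [IsNoetherianRing B] [IsDomain C] [Module.Finite B C]
    (hinj : Function.Injective (algebraMap B C)) {c₀ : B}
    (hc₀ : ∀ γ : C, ∃ b : B, algebraMap B C b = algebraMap B C c₀ * γ) (hc₀0 : algebraMap B C c₀ ≠ 0)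
    {n : ℕ} (hn : n ≤ 3) (hsat : cohomologyAnnihilator B = cohomologyAnnihilatorOfDegree B n)
    {x : B} (hx : x ∈ cohomologyAnnihilator B) (γ : C) :
    ∃ b : B, algebraMap B C b = algebraMap B C x * γ := by
  rw [hsat] at hx
  exact exists_eq_mul_of_mem_cohomologyAnnihilatorOfDegree_three hinj hc₀ hc₀0
    (cohomologyAnnihilatorOfDegree_mono hn hx) γ

/-! ## Appendix (same seat, later the same day): non-domain overrings — cancel by a NONZERODIVISOR conductor element -/

/-- For a conductor element `c₀` that is a NONZERODIVISOR in `C` (no domain hypothesis: e.g. `C` a product of the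
normalisations of the branches of a reduced curve), every `B`-linear `θ : C → B` is `γ ↦ γ·θ(1)`. [folklore] -/
theorem algebraMap_dual_apply_eq_mul_of_mem_nonZeroDivisors {c₀ : B}
    (hc₀ : ∀ γ : C, ∃ b : B, algebraMap B C b = algebraMap B C c₀ * γ)
    (hc₀0 : algebraMap B C c₀ ∈ nonZeroDivisors C) (θ : Module.Dual B C) (γ : C) :
    algebraMap B C (θ γ) = γ * algebraMap B C (θ 1) := by
  obtain ⟨b, hb⟩ := hc₀ γ
  have h1 : c₀ • γ = b • (1 : C) := by
    rw [Algebra.smul_def, Algebra.smul_def, mul_one, hb]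
  have h2 : c₀ * θ γ = b * θ 1 := by
    rw [← smul_eq_mul, ← smul_eq_mul, ← map_smul, ← map_smul, h1]
  have h3 := congrArg (algebraMap B C) h2
  rw [map_mul, map_mul, hb] at h3
  have h4 : (algebraMap B C (θ γ) - γ * algebraMap B C (θ 1)) * algebraMap B C c₀ = 0 := by
    rw [sub_mul, mul_comm _ (algebraMap B C c₀), h3]; ring
  exact sub_eq_zero.mp ((mul_right_mem_nonZeroDivisors_eq_zero_iff hc₀0).mp h4)

/-- `θ(1) • θ' = θ'(1) • θ`, nonzerodivisor form. [folklore] -/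
theorem apply_one_smul_comm_of_mem_nonZeroDivisors (hinj : Function.Injective (algebraMap B C)) {c₀ : B}
    (hc₀ : ∀ γ : C, ∃ b : B, algebraMap B C b = algebraMap B C c₀ * γ)
    (hc₀0 : algebraMap B C c₀ ∈ nonZeroDivisors C) (θ θ' : Module.Dual B C) : θ 1 • θ' = θ' 1 • θ := by
  refine LinearMap.ext fun δ => hinj ?_
  rw [LinearMap.smul_apply, LinearMap.smul_apply, smul_eq_mul, smul_eq_mul, map_mul, map_mul,
    algebraMap_dual_apply_eq_mul_of_mem_nonZeroDivisors hc₀ hc₀0 θ' δ,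
    algebraMap_dual_apply_eq_mul_of_mem_nonZeroDivisors hc₀ hc₀0 θ δ]
  ring

/-- **THE CONDUCTOR CEILING, ring-map form, REDUCED version**: `B` noetherian, `B → C` injective with `C` module-finite over
`B` (any commutative `C` — e.g. the product of the normalisations of the branches), `c₀` a conductor element that is a
nonzerodivisor in `C`.  Then every `x ∈ ca³(B)` is a conductor element. [cite: IyengarTakahashi2014, Remark 2.13] -/
theorem exists_eq_mul_of_mem_cohomologyAnnihilatorOfDegree_three_of_mem_nonZeroDivisors [IsNoetherianRing B]
    [Module.Finite B C] (hinj : Function.Injective (algebraMap B C)) {c₀ : B}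
    (hc₀ : ∀ γ : C, ∃ b : B, algebraMap B C b = algebraMap B C c₀ * γ) (hc₀0 : algebraMap B C c₀ ∈ nonZeroDivisors C)
    {x : B} (hx : x ∈ cohomologyAnnihilatorOfDegree B 3) (γ : C) :
    ∃ b : B, algebraMap B C b = algebraMap B C x * γ := by
  classical
  obtain ⟨X, hX, h2⟩ := exists_isSyzygy_two_dual (A := B) C
  have hsa : StablyAnnihilates B x (ModuleCat.of B (Module.Dual B C)) :=
    (mem_cohomologyAnnihilatorOfDegree_succ_iff_forall_isSyzygy (n := 2) x).mp hx X _ hX h2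
  obtain ⟨s, ι, π, hιπ⟩ := (stablyAnnihilates_iff_exists_linearMap x (ModuleCat.of B (Module.Dual B C))).mp hsa
  have hπι : ∀ θ : Module.Dual B C, π (ι θ) = x • θ := fun θ => by
    simpa using LinearMap.congr_fun hιπ θ
  obtain ⟨θ₀, hθ₀⟩ := exists_linearMap_conductor hinj hc₀
  have hθ₀1 : θ₀ 1 = c₀ := hinj (by rw [hθ₀, mul_one])
  let p : Fin s → Module.Dual B C := fun i => π (Pi.single i 1)
  let q : Fin s → Module.Dual B C := fun i => (p i) ∘ₗ LinearMap.mulLeft B γ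
  have hq1 : ∀ i, q i 1 = p i γ := fun i => by
    simp [q, LinearMap.mulLeft_apply]
  have hcq : ∀ i, c₀ • q i = p i γ • θ₀ := fun i => by
    rw [← hθ₀1, apply_one_smul_comm_of_mem_nonZeroDivisors hinj hc₀ hc₀0 θ₀ (q i), hq1]
  refine ⟨∑ i, ι (q i) i, ?_⟩
  have key : c₀ * ∑ i, ι (q i) i = x * θ₀ γ := by
    rw [Finset.mul_sum]
    have hterm : ∀ i, c₀ * ι (q i) i = p i γ * ι θ₀ i := fun i => by
      rw [← smul_eq_mul, ← Pi.smul_apply, ← map_smul, hcq i, map_smul, Pi.smul_apply, smul_eq_mul]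
    simp_rw [hterm]
    have h := hπι θ₀
    rw [linearMap_pi_apply_eq_sum π (ι θ₀)] at h
    have h' := LinearMap.congr_fun h γ
    rw [LinearMap.coe_sum, Finset.sum_apply, LinearMap.smul_apply] at h'
    simp only [LinearMap.smul_apply, smul_eq_mul] at h'
    rw [← h']
    exact Finset.sum_congr rfl fun i _ => mul_comm _ _
  have key' := congrArg (algebraMap B C) key
  rw [map_mul, map_mul, hθ₀ γ] at key'
  have h4 : (algebraMap B C (∑ i, ι (q i) i) - algebraMap B C x * γ) * algebraMap B C c₀ = 0 := by
    rw [sub_mul, mul_comm _ (algebraMap B C c₀), key']; ring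
  exact sub_eq_zero.mp ((mul_right_mem_nonZeroDivisors_eq_zero_iff hc₀0).mp h4)

end Summit.ResolutionOfSingularities.ResolutionOfSingularities.Theorems.HomologicalConductor.ConductorCeilingRingHom

end
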